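import Literature.MathematicalPhysics.QuantumFieldTheory.Balaban1983to89.T4ContinuumYM4Torus
import Summits.QuantumFields.BalabanUV.Gaps.EndDrawdownBand

/-!
# Gaps / EndDrawdownHeadline — the drawdown node AT BAŁABAN's DATUM and AT THE PRINT-FAITHFUL T⁴ HEADLINE: for a finite-ε datum `D` the END
# binder `hEnd : EndpointExistence D.C.toB12` of `T4ContinuumYM4Torus.continuumYM4_torus_of_endpointExistence_nonvacuous` is SUPPLIED by
# «a printed split of `D.βfun` with bounded drawdown `DwSeq β⁰ rlo`, a one-sided remainder class `[−rlo, rhi]` (per-level upper constants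
# suffice) and (C) on ONE box `]0,γ₀]`» and FORCES «`DwSeq β⁰ (−rhi)`» — so the NON-VACUOUS headline holds from (B), the spine slot, (C),
# row (D4)'s constant-form remainder on one box, and ONE one-loop statement: bounded drawdown of `β⁰` below the lower remainder line — in
# particular from an EVENTUAL floor `β⁰_j ≥ rr` (`j ≥ k₀`) with NOTHING asked of the first `k₀` coefficients (the CAP).  Datum-level
# transport (this seat) of `Gaps/EndDrawdownBand` (port of g1-plan-2's kernel `B12Thm2SubDag_plan2.lean` v1.15 §11–§13); cell
# pub-balaban-gaps, seat g1-p3 GEN 8, rows CAP ∕ tail «split ∕ weakening»; file 6 of «the one-loop interface of the END statement».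

HONEST FRAMING (cell rule, page 1 of everything): one-line compositions of tree theorems; every β-side hypothesis is a BINDER on Bałaban's
(unlocated) β-functions `D.βfun` — the split `Sβ`, `DwSeq Sβ.β0 rlo`, the remainder class, (C); instance 0∕1 for Bałaban's family (NODE-O; no
`β⁰_k`, no remainder constant certified; CAP coefficients certified 0).  The conclusion `ContinuumYM4Torus D ∧ ContinuumYM4TorusE D` is the
cell's finite-T⁴ headline (one finite torus at fixed ε, Wilson action), NOT the continuum limit on ℝ⁴, NOT infinite volume, NOT the mass gap,
NOT Clay; (B) `B16.EndStatementBPrinted` and the spine slot `HybridNE7Under` are the OTHER binders, untouched here (0∕6 discharged).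
[I] Thm 2 is UNPROVED in print; nothing of Bałaban's is asserted.

CITATION HEADER (tags CONTEXT ONLY).  [I] = T. Bałaban, Commun. Math. Phys. **109** (1987) 249–301 [Balaban1987RG1]: Thm 2 p. 259 (first
sentence), (2.12)–(2.14) p. 268; [B16] = T. Bałaban, Commun. Math. Phys. **122** (1989) 355–392 [Balaban1989LargeFieldII] (statement (B)).
-/

namespace Summit.QuantumFields.BalabanUV.Gaps.EndDrawdownHeadline

open Literature.MathematicalPhysics.QuantumFieldTheory.Balaban1983to89
open Literature.MathematicalPhysics.QuantumFieldTheory.Balaban1983to89.FlowStep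
open Literature.MathematicalPhysics.QuantumFieldTheory.Balaban1983to89.FlowStepRuns
open Literature.MathematicalPhysics.QuantumFieldTheory.Balaban1983to89.DagBinding
open Literature.MathematicalPhysics.QuantumFieldTheory.Balaban1983to89.Beta.RemainderChain (RemainderConst)
open Literature.MathematicalPhysics.QuantumFieldTheory.Balaban1983to89.T4Continuum
open Literature.MathematicalPhysics.QuantumFieldTheory.Balaban1983to89.T4ContinuumYM4Torus
open Summit.QuantumFields.BalabanUV.Gaps.EndDrawdownSeq
open Summit.QuantumFields.BalabanUV.Gaps.EndDrawdownBand
open Finset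

universe u

noncomputable section

/-! ## §1 At the datum: the END binder from ∕ to the drawdown node (forward generation is the datum's FIELD `D.fwd`) -/

section Datum

variable {F : T4Family} {G : Type u} [GaugeGroup G] [MeasurableSpace G] [HaarData G]

/-- **END OF THE DATUM FROM THE DRAWDOWN NODE, WEAKEST FORM** · a printed split `Sβ` of `D.βfun`, bounded drawdown `DwSeq Sβ.β0 rlo`, (Q3) ONE uniform
lower remainder constant and (Q4)_k PER-LEVEL upper constants on the `]0,γ₀]`-histories, (C) on the `]0,γ₀]`-boxes ⟹ `EndpointExistence D.C.toB12`.
No bound on `β⁰` from above, no slope, no pin, no rate, no sign of any coefficient. [cite: Balaban1987RG1, Thm 2 p.259 (first sentence)] -/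
theorem endpointExistence_datum_of_dwSeq (D : FiniteEpsData F G) (Sβ : B12Beta.OneLoopSplit D.βfun) {γ₀ rlo : ℝ} (hγ₀ : 0 < γ₀)
    (hDw : DwSeq Sβ.β0 rlo) (hlo : ∀ (k : ℕ) (p : Fin (k + 1) → ℝ), p ∈ B12Beta.HistBox γ₀ k → -rlo ≤ Sβ.β1 k p)
    (hup : ∀ k : ℕ, ∃ r : ℝ, ∀ p : Fin (k + 1) → ℝ, p ∈ B12Beta.HistBox γ₀ k → Sβ.β1 k p ≤ r)
    (hcont : BetaContH γ₀ D.βfun) : EndpointExistence D.C.toB12 :=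
  endpointExistence_of_dwSeq_lower_locUpper D.fwd Sβ hγ₀ hDw hlo hup hcont

/-- END OF THE DATUM over row (D4)'s symmetric class · split, `DwSeq Sβ.β0 rr`, `RemainderConst Sβ γ₀ rr`, (C) ⟹ `EndpointExistence D.C.toB12`.
[cite: Balaban1987RG1, Thm 2 p.259 (first sentence)] -/
theorem endpointExistence_datum_of_dwSeq_remainderConst (D : FiniteEpsData F G) (Sβ : B12Beta.OneLoopSplit D.βfun) {γ₀ rr : ℝ}
    (hγ₀ : 0 < γ₀) (hDw : DwSeq Sβ.β0 rr) (hrem : RemainderConst Sβ γ₀ rr) (hcont : BetaContH γ₀ D.βfun) :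
    EndpointExistence D.C.toB12 :=
  endpointExistence_of_dwSeq_remainderConst D.fwd Sβ hγ₀ hDw hrem hcont

/-- **THE CAP-FREE END OF THE DATUM** · split, an EVENTUAL floor `f ≤ β⁰_j` (`j ≥ k₀`) with `rr ≤ f`, `RemainderConst Sβ γ₀ rr`, (C) ⟹
`EndpointExistence D.C.toB12` — NOTHING asked of `β⁰_0, …, β⁰_{k₀−1}`: the headline's END binder does not read the CAP.
[cite: Balaban1987RG1, Thm 2 p.259 (first sentence) and (2.12)–(2.14) p.268] -/
theorem endpointExistence_datum_of_eventualFloor (D : FiniteEpsData F G) (Sβ : B12Beta.OneLoopSplit D.βfun) {f rr γ₀ : ℝ} {k₀ : ℕ}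
    (hF : ∀ j, k₀ ≤ j → f ≤ Sβ.β0 j) (hr : rr ≤ f) (hγ₀ : 0 < γ₀) (hrem : RemainderConst Sβ γ₀ rr) (hcont : BetaContH γ₀ D.βfun) :
    EndpointExistence D.C.toB12 :=
  endpointExistence_of_eventualFloor_remainderConst D.fwd Sβ hF hr hγ₀ hrem hcont

/-- NECESSITY AT THE DATUM · split with `β¹ ≤ rhi` on the `]0,γ₀]`-histories and `EndpointExistence D.C.toB12` ⟹ `DwSeq Sβ.β0 (−rhi)` — the headline's
END binder FORCES bounded drawdown of the one-loop coefficients below the `(−rhi)`-line (realised window inequality; forward generation = `D.fwd`).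
[cite: Balaban1987RG1, (0.20) p.256 and Thm 2 p.259] -/
theorem dwSeq_neg_of_endpointExistence_datum (D : FiniteEpsData F G) (Sβ : B12Beta.OneLoopSplit D.βfun) {γ₀ rhi : ℝ} (hγ₀ : 0 < γ₀)
    (hup : ∀ k (p : Fin (k + 1) → ℝ), p ∈ B12Beta.HistBox γ₀ k → Sβ.β1 k p ≤ rhi) (hE : EndpointExistence D.C.toB12) :
    DwSeq Sβ.β0 (-rhi) :=
  dwSeq_neg_of_endpointExistence_upper D.fwd Sβ hγ₀ hup hE

/-- THE SANDWICH AT THE DATUM · split with remainder in `[−rlo, rhi]` on `]0,γ₀]`, (C): `DwSeq β⁰ rlo ⟹ EndpointExistence D.C.toB12 ⟹ DwSeq β⁰ (−rhi)`.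
[cite: Balaban1987RG1, Thm 2 p.259 (first sentence)] -/
theorem endpointExistence_datum_sandwich (D : FiniteEpsData F G) (Sβ : B12Beta.OneLoopSplit D.βfun) {γ₀ rlo rhi : ℝ} (hγ₀ : 0 < γ₀)
    (hrem : RemainderLU Sβ γ₀ rlo rhi) (hcont : BetaContH γ₀ D.βfun) :
    (DwSeq Sβ.β0 rlo → EndpointExistence D.C.toB12) ∧ (EndpointExistence D.C.toB12 → DwSeq Sβ.β0 (-rhi)) :=
  endpointExistence_sandwich_remainderLU D.fwd Sβ hγ₀ hrem hcont

end Datum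

/-! ## §2 At the print-faithful T⁴ headline (non-vacuous form, `continuumYM4_torus_of_endpointExistence_nonvacuous` BY NAME) -/

section DatumSU

variable {F : T4Family} {N : ℕ} [NeZero N]

/-- **THE PRINT-FAITHFUL T⁴ HEADLINE FROM THE DRAWDOWN NODE.**  Printed-averaged datum on `SU(N)`; binders: (B), a printed split `Sβ` of `D.βfun` with
bounded drawdown `DwSeq Sβ.β0 rlo`, remainder in the one-sided box `[−rlo, rhi]` on the `]0,γ₀]`-histories, (C) on the `]0,γ₀]`-boxes, and the spine
slot under the END binder; conclusion `ContinuumYM4Torus D ∧ ContinuumYM4TorusE D`.  NO sign ∕ floor ∕ rate ∕ limit of any one-loop coefficient, NO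
bound on `β⁰` from above, NO slope, NO pin to a table: the headline's ENTIRE one-loop input is one drawdown statement.  Decides nothing (binders;
instance 0∕1; one finite T⁴; NOT Clay). [cite: Balaban1987RG1, Thm 2 p.259 (first sentence) and (2.12)–(2.14) p.268] -/
theorem continuumYM4Torus_of_dwSeq (D : FiniteEpsData F (Matrix.specialUnitaryGroup (Fin N) ℂ)) (hD : D.IsPrintedAveraged)
    (hB : B16.EndStatementBPrinted D.C) (Sβ : B12Beta.OneLoopSplit D.βfun) {γ₀ rlo rhi : ℝ} (hγ₀ : 0 < γ₀) (hDw : DwSeq Sβ.β0 rlo)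
    (hrem : RemainderLU Sβ γ₀ rlo rhi) (hcont : BetaContH γ₀ D.βfun)
    (hNE : T4ApexHybrid.HybridNE7Under D (EndpointExistence D.C.toB12)) : ContinuumYM4Torus D ∧ ContinuumYM4TorusE D :=
  continuumYM4_torus_of_endpointExistence_nonvacuous D hD hB
    (endpointExistence_of_dwSeq_remainderLU D.fwd Sβ hγ₀ hDw hrem hcont) hNE

/-- **THE PRINT-FAITHFUL T⁴ HEADLINE, WEAKEST TYPED (D4)-USE** · as above with (Q3) ONE uniform lower remainder constant and (Q4)_k PER-LEVEL upper
constants in place of the box `[−rlo, rhi]`. [cite: Balaban1987RG1, Thm 2 p.259 (first sentence) and (2.12)–(2.14) p.268] -/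
theorem continuumYM4Torus_of_dwSeq_locUpper (D : FiniteEpsData F (Matrix.specialUnitaryGroup (Fin N) ℂ)) (hD : D.IsPrintedAveraged)
    (hB : B16.EndStatementBPrinted D.C) (Sβ : B12Beta.OneLoopSplit D.βfun) {γ₀ rlo : ℝ} (hγ₀ : 0 < γ₀) (hDw : DwSeq Sβ.β0 rlo)
    (hlo : ∀ (k : ℕ) (p : Fin (k + 1) → ℝ), p ∈ B12Beta.HistBox γ₀ k → -rlo ≤ Sβ.β1 k p)
    (hup : ∀ k : ℕ, ∃ r : ℝ, ∀ p : Fin (k + 1) → ℝ, p ∈ B12Beta.HistBox γ₀ k → Sβ.β1 k p ≤ r) (hcont : BetaContH γ₀ D.βfun)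
    (hNE : T4ApexHybrid.HybridNE7Under D (EndpointExistence D.C.toB12)) : ContinuumYM4Torus D ∧ ContinuumYM4TorusE D :=
  continuumYM4_torus_of_endpointExistence_nonvacuous D hD hB (endpointExistence_datum_of_dwSeq D Sβ hγ₀ hDw hlo hup hcont) hNE

/-- **THE CAP-FREE PRINT-FAITHFUL T⁴ HEADLINE** · printed-averaged datum on `SU(N)`; (B); a printed split of `D.βfun` whose one-loop coefficients have
an EVENTUAL floor `f ≤ β⁰_j` (`j ≥ k₀`) with `rr ≤ f`; row (D4)'s `RemainderConst Sβ γ₀ rr` on one box; (C); the spine slot ⟹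
`ContinuumYM4Torus D ∧ ContinuumYM4TorusE D` — with NO statement about the first `k₀` one-loop coefficients: the row-CAP sign list is not an input
of the headline (it is an input of (0.31) as printed only).  Decides nothing. [cite: Balaban1987RG1, Thm 2 p.259 (first sentence) and (2.12)–(2.14) p.268] -/
theorem continuumYM4Torus_of_eventualFloor (D : FiniteEpsData F (Matrix.specialUnitaryGroup (Fin N) ℂ)) (hD : D.IsPrintedAveraged)
    (hB : B16.EndStatementBPrinted D.C) (Sβ : B12Beta.OneLoopSplit D.βfun) {f rr γ₀ : ℝ} {k₀ : ℕ}
    (hF : ∀ j, k₀ ≤ j → f ≤ Sβ.β0 j) (hr : rr ≤ f) (hγ₀ : 0 < γ₀) (hrem : RemainderConst Sβ γ₀ rr)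
    (hcont : BetaContH γ₀ D.βfun) (hNE : T4ApexHybrid.HybridNE7Under D (EndpointExistence D.C.toB12)) :
    ContinuumYM4Torus D ∧ ContinuumYM4TorusE D :=
  continuumYM4_torus_of_endpointExistence_nonvacuous D hD hB
    (endpointExistence_datum_of_eventualFloor D Sβ hF hr hγ₀ hrem hcont) hNE

end DatumSU

end

end Summit.QuantumFields.BalabanUV.Gaps.EndDrawdownHeadline
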